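import Summits.FinalStateConjecture.FinalStateConjecture.Theses.PhotonSphereChannels
import Summits.FinalStateConjecture.FinalStateConjecture.Theorems.PhotonSphereChannelsWindowedShellChannelsOfZonePoly

/-!
# Crux `WindowedShellChannels` (stmt-FinalStateConjecture-14085) — line `coulomb-phase`
# (crux-strategist s2: the Coulomb-phase decoherence line of crux idea `coulomb-phase-decoherence`, lens negation + transfer)

The kernel of W (`stub_zonePoly σ`, W ⟺ kernel by the landed `windowedShellChannels_of_zonePoly` p135139) read on the RADIATION side:
`caught_even/odd(u₀) = A ∓ sB` with `Z(u) = ∫c(ω)e^{i(θ_ℓ(ω)−ωu)}dω`, `E = 2π∫c²`, `A = ∫_{u<u₀}|Z|²`, `B = Re∫_{u<u₀}Z²` (lead c4,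
Lines/Sketch-c4.md §1b).  Two stubs:

* `stub_coulombPhaseLemma` — (F3′) the TYPED OBSTRUCTION to every counterexample: pure harmonic analysis on the line, Mathlib only.  For phases
  with log-curvature pinned on both sides (`a/ω ≤ θ″ ≤ A/ω`), group delays before the window edge (`θ′ ≤ u₀`) and a benign zero-frequency limit
  (`θ(0⁺) ∈ (π/2)ℤ`): `A − |B| ≥ c₀(a,A)·E` for every real continuous compactly supported density.  c4's one-sided version (only `ωθ″ ≥ a`) is
  FALSE (delay-kink construction = the integer model on a low band, kit j023605); the two-sided version passed its first adversarial tests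
  (j023605: min 0.43–0.46 over 279 designs for A/a ≤ 10; j023630: projected-gradient descent over the curvature profile finds minima 0.45/0.41/
  0.38/0.35 at A/a = 2/5.2/10/20, identical at 9 and 13 e-folds — no decay with band length).  Anchor (constant benign phase: `A(0) = E/2`,
  `B(0) = 0`) provable today.
* `stub_spectralReduction` — (F3′) ⇒ the kernel for every real parity `σ`: the Regge–Wheeler SPECTRAL PACKAGE — per-mode distorted Plancherel
  and radiation field for `−∂² + V_{s,ℓ}` on the tortoise line (Deift–Trubowitz; Dimock–Kay), the ℓ-uniform Langer/Olver phase asymptotics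
  `θ_ℓ = LΦ(ω/L) + O(1/ℓ)` with `ωθ_ℓ″ ∈ [2M⁻, A(ρ)]` below the top band and `θ_ℓ(0⁺) = −(ℓ+1)π/2`, the barrier-top band (support-aware:
  data off the shell have no rest component at the top; the lingering half is sacrificed by parity, LagLaw `3√3·M·log(M/ρ)`), and the band
  coupling.  This stub needs vocabulary the tree lacks (1-D scattering theory); it is the honest remainder, named.

`WindowedShellChannels_of` = `windowedShellChannels_of_zonePoly (stub_spectralReduction stub_coulombPhaseLemma)`.  Sorries ONLY in `stub_*`.
The live skeleton `Lines/Sketch.lean` (lead c4) is untouched; the companion decomposition line is `Lines/parity_kernels.lean`.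
-/

noncomputable section

set_option linter.dupNamespace false

namespace Summit.FinalStateConjecture.FinalStateConjecture.Cruxes.WindowedShellChannels.CoulombPhaseLine

open Literature.Geometry.Lorentzian Literature.Geometry.Lorentzian.ReggeWheeler
open Summit.FinalStateConjecture.FinalStateConjecture.Theses.PhotonSphereChannels
open Summit.FinalStateConjecture.FinalStateConjecture.Theorems.WindowedShellChannelsSketch
open Filter Set MeasureTheory
open scoped ENNReal Topology

/-- STUB 1 — (F3′) THE COULOMB-PHASE CHANNEL LEMMA (pure harmonic analysis; Mathlib only; conjectural, first adversarial tests passed: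
kit j023605 / j023630).  By scaling only `A/a` matters.  Anchor: constant benign phase gives `A(0) = E/2`, `B(0) = 0` exactly. -/
theorem stub_coulombPhaseLemma :
    ∀ a A : ℝ, 0 < a → a ≤ A → ∃ c₀ : ℝ, 0 < c₀ ∧ ∀ (W u₀ : ℝ), 0 < W → ∀ (θ θ' θ'' : ℝ → ℝ),
      (∀ ω ∈ Set.Ioo 0 W, HasDerivAt θ (θ' ω) ω ∧ HasDerivAt θ' (θ'' ω) ω) →
      (∀ ω ∈ Set.Ioo 0 W, a / ω ≤ θ'' ω ∧ θ'' ω ≤ A / ω) →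
      (∀ ω ∈ Set.Ioo 0 W, θ' ω ≤ u₀) →
      (∃ m : ℤ, Tendsto θ (𝓝[>] 0) (𝓝 (m * Real.pi / 2))) →
      ∀ c : ℝ → ℝ, Continuous c → HasCompactSupport c → Function.support c ⊆ Set.Ioo 0 W →
        let Z : ℝ → ℂ := fun u => ∫ ω, (c ω : ℂ) * Complex.exp (Complex.I * ((θ ω : ℂ) - (ω : ℂ) * (u : ℂ)))
        c₀ * (2 * Real.pi * ∫ ω, c ω ^ 2) ≤
          (∫ u in Set.Iic u₀, ‖Z u‖ ^ 2) - |(∫ u in Set.Iic u₀, Z u ^ 2).re| := by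
  sorry

/-- STUB 2 — THE REGGE–WHEELER SPECTRAL REDUCTION: (F3′) implies the polynomial-zone kernel for every real time parity `σ` (only `σ = ±1`
carry content).  Content: distorted Plancherel + radiation field per mode (exact forms `caught = A ∓ sB` up to tunnelling and near-side
terms), ℓ-uniform phase asymptotics (benign start, curvature pinned in `[M, A(ρ)]` below `ω_b(ρ)`, group delays `≤ h(ρ) − ρ`), the
barrier-top band (support-aware, parity-sacrificed lingering half) and the coupling of bands.  Needs 1-D scattering vocabulary absent
from the tree — the honest remainder of the line. -/
theorem stub_spectralReduction :
    (∀ a A : ℝ, 0 < a → a ≤ A → ∃ c₀ : ℝ, 0 < c₀ ∧ ∀ (W u₀ : ℝ), 0 < W → ∀ (θ θ' θ'' : ℝ → ℝ),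
      (∀ ω ∈ Set.Ioo 0 W, HasDerivAt θ (θ' ω) ω ∧ HasDerivAt θ' (θ'' ω) ω) →
      (∀ ω ∈ Set.Ioo 0 W, a / ω ≤ θ'' ω ∧ θ'' ω ≤ A / ω) →
      (∀ ω ∈ Set.Ioo 0 W, θ' ω ≤ u₀) →
      (∃ m : ℤ, Tendsto θ (𝓝[>] 0) (𝓝 (m * Real.pi / 2))) →
      ∀ c : ℝ → ℝ, Continuous c → HasCompactSupport c → Function.support c ⊆ Set.Ioo 0 W →
        let Z : ℝ → ℂ := fun u => ∫ ω, (c ω : ℂ) * Complex.exp (Complex.I * ((θ ω : ℂ) - (ω : ℂ) * (u : ℂ)))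
        c₀ * (2 * Real.pi * ∫ ω, c ω ^ 2) ≤
          (∫ u in Set.Iic u₀, ‖Z u‖ ^ 2) - |(∫ u in Set.Iic u₀, Z u ^ 2).re|) →
    ∀ σ : ℝ, ∀ ρ : ℝ, 0 < ρ → ∃ h : ℝ, 0 ≤ h ∧ ∃ c : ℝ, 0 < c ∧ ∀ k : ℕ, ∃ ℓ₀ : ℕ,
      ∀ (s ℓ : ℕ), s ≤ 2 → s ≤ ℓ → ℓ₀ ≤ ℓ → ∀ ψ : ℝ → ℝ → ℝ,
        IsRWSolution 1 s ℓ (tortoiseRadius one_pos 0) ψ → (∀ t x, ψ (-t) x = σ * ψ t x) →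
        CauchyDataSupportedOn ψ ({x : ℝ | ρ < |x|} ∩ Icc (-(((ℓ : ℝ) + 2) ^ k)) (((ℓ : ℝ) + 2) ^ k)) →
        totalEnergy (linePotential 1 s ℓ (tortoiseRadius one_pos 0)) ψ 0 ≠ ⊤ →
          ENNReal.ofReal c * totalEnergy (linePotential 1 s ℓ (tortoiseRadius one_pos 0)) ψ 0 ≤
            channelEnergy (linePotential 1 s ℓ (tortoiseRadius one_pos 0)) 0 (ρ - h) ψ atTop := by
  sorry

/-- **Line `coulomb-phase` closes the crux modulo its two stubs** (kernel reduction `windowedShellChannels_of_zonePoly`, landed p135139). -/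
theorem WindowedShellChannels_of : WindowedShellChannels :=
  windowedShellChannels_of_zonePoly (stub_spectralReduction stub_coulombPhaseLemma)

end Summit.FinalStateConjecture.FinalStateConjecture.Cruxes.WindowedShellChannels.CoulombPhaseLine

end
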